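import Literature.NumberTheory.Automorphic.OrbitalMeasureOfLocalQuotient
import Literature.NumberTheory.Automorphic.UnitaryGroupOrbitalMeasureOfLocal
import HarnessLib

/-!
# `U(H)`'s orbital measures built from local QUOTIENT measures ARE the quotient measures of the restricted-product Haar measures:
# `ofLocal (dg_v ∕ dt_v) = dg ∕ dt` on `U(H)(𝔸_{L⁺,f}) ⧸ C(g_f)` and on `U(H)(𝔸_{L⁺}) ⧸ C(g)`, Weil constant ONE
(Rogawski, *Automorphic representations of unitary groups in three variables* (1990), §4.3 p. 44, §5.4 p. 72: `dg = ⊗_v dg_v`, `dt = ⊗_v dt_v`,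
`Φ(γ, ⊗ f_v) = ∏_v Φ(γ_v, f_v)`; Tate, in Cassels–Fröhlich (1967) Ch. XV §3.3; Gelbart (1975) p. 155 (10.19))

Topic `NumberTheory/Automorphic`; THEOREMS ONLY (no definition, no instance, no named fact).  The `U(H)` dress of ★
`orbitalMeasureOfLocal_eq_quotientMeasure` ∕ ★ `orbitalMeasureOfProd_quotientMeasure_eq_quotientMeasure` (`OrbitalMeasureOfLocalQuotient`) over
★ `UnitaryGroup.finAdelicOrbitalMeasureOfLocal` ∕ ★ `UnitaryGroup.adelicOrbitalMeasureOfLocal` (`UnitaryGroupOrbitalMeasureOfLocal`):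

* §1 `isHaarMeasure_map_subgroupCongrHomeomorph` — book-keeping: a Haar measure on `H ≤ G` transported along the restriction `H ≃ₜ H′` of an
  isomorphism of topological groups `e : G ≃* G′` is a Haar measure on `H′`;
* §2 **`UnitaryGroup.finAdelicOrbitalMeasureOfLocal_quotientMeasure_eq`** — for Haar measures `ν_v` on `U(H)(L⁺_v)` (`ν_v(U(H)(𝒪_v)) = 1` off `S₀`),
  Haar measures `t_v` on the local centralisers `C(g_v)` (`t_v(C(g_v) ∩ U(H)(𝒪_v)) = 1` off `S₀`) with `(ν_v ∕ t_v)(π U(H)(𝒪_v)) = 1` off `S₀`: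
  `finAdelicOrbitalMeasureOfLocal L N H g (v ↦ ν_v ∕ t_v) S₀ = ν_f ∕ t_f` for the restricted-product Haar measures `ν_f = ∏'_v (ν_v ; U(H)(𝒪_v))`,
  `t_f = ∏'_v (t_v ; C(g_v) ∩ U(H)(𝒪_v))` read on `U(H)(𝔸_{L⁺,f})`, `C(g_f)` through ★ `finAdelicEquiv` ∕ ★ `localPiEquiv` ∕ ★ `cutoutEquiv`
  (the measures are EXPRESSIONS over ★ `rpMeasure`, supplied with their equations `hνrp … htf`).

(The full adelic statement on `U(H)(𝔸_{L⁺}) ⧸ C(g)` — the `∞ × f` step along ★ `adelicProdEquiv` — is the sibling file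
`UnitaryGroupAdelicOrbitalMeasureOfLocalQuotient`.)

WHY.  (O10-b3) of the F0/P3a line «measure coherence»: with CANONICAL local torus measures (★-to-be `IsCanonical`, F3) the kit's `ofLocal`
family at a regular class is `dg ∕ dt` for THE restricted-product torus measure, whose covolume `m(T(L⁺) \ T(𝔸))` is the orbital weight of
★ `UnitaryGroupDiagTraceNormalized` ∕ ★ `AdelicGroupDataGeometricSideCovol` and is transported across a stable class by ★ `LatticeCovolumeTransport`.

## References
* J. D. Rogawski, *Automorphic Representations of Unitary Groups in Three Variables* (1990), §4.3 p. 44, §5.4 p. 72 [Rogawski1990].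
* J. W. S. Cassels, A. Fröhlich (eds.), *Algebraic Number Theory* (1967), Ch. XV (Tate) §3.3 [CasselsFrohlichANT1967].
* S. Gelbart, *Automorphic forms on adele groups* (1975), p. 155 (10.19) [Gelbart1975].
-/

set_option autoImplicit false

noncomputable section

open _root_.MeasureTheory _root_.MeasureTheory.Measure Set Filter Function NumberField IsDedekindDomain
open _root_.Topology
open Literature.Topology.RestrictedProduct Literature.Topology.Algebra.RestrictedProduct Literature.MeasureTheory.Group
open Literature.MeasureTheory.RestrictedProduct
open scoped RestrictedProduct ENNReal NNReal Pointwise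

/-! ## §1 Haar measures transported along restrictions of group isomorphisms -/

namespace Literature.MeasureTheory.Group

section HaarTransport

variable {G G' : Type*} [Group G] [Group G'] [TopologicalSpace G] [TopologicalSpace G']
  [IsTopologicalGroup G] [IsTopologicalGroup G'] [MeasurableSpace G] [BorelSpace G] [MeasurableSpace G'] [BorelSpace G']
  (e : G ≃* G') (he : Continuous e) (hes : Continuous e.symm)
  (H : Subgroup G) (H' : Subgroup G') (hHH' : ∀ g, e g ∈ H' ↔ g ∈ H)

/-- **A Haar measure on `H` transported along the restriction `H ≃ₜ H′` of `e : G ≃* G′` is a Haar measure on `H′`** (the restriction is an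
isomorphism of topological groups; Mathlib `MulEquiv.isHaarMeasure_map`). [cite: CasselsFrohlichANT1967, Ch. XV (Tate) §3.3] -/
theorem isHaarMeasure_map_subgroupCongrHomeomorph [LocallyCompactSpace H] (ρ : Measure H) [IsHaarMeasure ρ] :
    IsHaarMeasure (Measure.map (subgroupCongrHomeomorph e H H' hHH' he hes) ρ) := by
  let f : H ≃* H' :=
    { toFun := fun h => ⟨e h, (hHH' h).2 h.2⟩
      invFun := fun h' => ⟨e.symm h', (forall_symm_mem_iff e H H' hHH' h').2 h'.2⟩
      left_inv := fun h => Subtype.ext (e.symm_apply_apply h)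
      right_inv := fun h' => Subtype.ext (e.apply_symm_apply h')
      map_mul' := fun a b => Subtype.ext (by simp only [Subgroup.coe_mul, map_mul]) }
  have hf : ⇑f = ⇑(subgroupCongrHomeomorph e H H' hHH' he hes) := rfl
  have h := MulEquiv.isHaarMeasure_map ρ f (hf ▸ (subgroupCongrHomeomorph e H H' hHH' he hes).continuous)
    (by
      have : ⇑f.symm = ⇑(subgroupCongrHomeomorph e H H' hHH' he hes).symm := rfl
      rw [this]; exact (subgroupCongrHomeomorph e H H' hHH' he hes).symm.continuous)
  rwa [hf] at h

/-- The transported measure is inversion invariant when `ρ` is. [cite: CasselsFrohlichANT1967, Ch. XV (Tate) §3.3] -/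
theorem isInvInvariant_map_subgroupCongrHomeomorph (ρ : Measure H) [ρ.IsInvInvariant] :
    (Measure.map (subgroupCongrHomeomorph e H H' hHH' he hes) ρ).IsInvInvariant := by
  let f : H ≃* H' :=
    { toFun := fun h => ⟨e h, (hHH' h).2 h.2⟩
      invFun := fun h' => ⟨e.symm h', (forall_symm_mem_iff e H H' hHH' h').2 h'.2⟩
      left_inv := fun h => Subtype.ext (e.symm_apply_apply h)
      right_inv := fun h' => Subtype.ext (e.apply_symm_apply h')
      map_mul' := fun a b => Subtype.ext (by simp only [Subgroup.coe_mul, map_mul]) }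
  have hf : ⇑f = ⇑(subgroupCongrHomeomorph e H H' hHH' he hes) := rfl
  have h := isInvInvariant_map_mulEquiv f (hf ▸ (subgroupCongrHomeomorph e H H' hHH' he hes).continuous.measurable) ρ
  rwa [hf] at h

/-- Right invariance passes to the push-forward along an isomorphism of measurable groups. [cite: CasselsFrohlichANT1967, Ch. XV (Tate) §3.3] -/
theorem isMulRightInvariant_map_mulEquiv_of_isMulRightInvariant {A B : Type*} [Group A] [Group B] [MeasurableSpace A] [MeasurableSpace B]
    [MeasurableMul A] [MeasurableMul B] (f : A ≃* B) (hf : Measurable f) (μ : Measure A) [μ.IsMulRightInvariant] :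
    (Measure.map f μ).IsMulRightInvariant := by
  refine ⟨fun b => ?_⟩
  obtain ⟨a, rfl⟩ := f.surjective b
  rw [Measure.map_map (measurable_mul_const (f a)) hf]
  have h1 : (fun x => x * f a) ∘ ⇑f = ⇑f ∘ fun x => x * a := by
    funext x; simp only [Function.comp_apply, map_mul]
  rw [h1, ← Measure.map_map hf (measurable_mul_const a), map_mul_right_eq_self μ a]

end HaarTransport

end Literature.MeasureTheory.Group

/-! ## §2 The finite-adelic orbital measure of `U(H)` from local quotient measures -/

namespace Literature.NumberTheory.Automorphic

namespace UnitaryGroup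

variable (L : Type) [Field L] [NumberField L] [IsCMField L] (N : ℕ) (H : Matrix (Fin N) (Fin N) L)

section Fin

variable (g : (cmDatum L N H).Adelic)
  [∀ v, MeasurableSpace ((cmDatum L N H).Local v)] [∀ v, BorelSpace ((cmDatum L N H).Local v)]
  -- the orbit spaces of ★ C1 (Borel structures)
  [∀ v, MeasurableSpace ((cmDatum L N H).Local v ⧸ Subgroup.centralizer ({((cmDatum L N H).toLocal v g)} : Set ((cmDatum L N H).Local v)))]
  [∀ v, BorelSpace ((cmDatum L N H).Local v ⧸ Subgroup.centralizer ({((cmDatum L N H).toLocal v g)} : Set ((cmDatum L N H).Local v)))]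
  [MeasurableSpace (finAdelic (↥(maximalRealSubfield L)) L (IsCMField.complexConj L) N H ⧸ Subgroup.centralizer
    ({(finPart (↥(maximalRealSubfield L)) L (IsCMField.complexConj L) N H g)} : Set (finAdelic (↥(maximalRealSubfield L)) L (IsCMField.complexConj L) N H)))]
  [BorelSpace (finAdelic (↥(maximalRealSubfield L)) L (IsCMField.complexConj L) N H ⧸ Subgroup.centralizer
    ({(finPart (↥(maximalRealSubfield L)) L (IsCMField.complexConj L) N H g)} : Set (finAdelic (↥(maximalRealSubfield L)) L (IsCMField.complexConj L) N H)))]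
  -- Borel structures on the restricted-product model `∏'_v (U(H)(F_v) : U(H)(𝒪_v))` and its orbit spaces (dischargeable: `borel`, ★ `borelSpace`)
  [∀ v, MeasurableSpace (↥(localPi L (IsCMField.complexConj L) N H v))] [∀ v, BorelSpace (↥(localPi L (IsCMField.complexConj L) N H v))]
  [∀ v, LocallyCompactSpace (↥(localPi L (IsCMField.complexConj L) N H v))] [∀ v, SecondCountableTopology (↥(localPi L (IsCMField.complexConj L) N H v))]
  [BorelSpace (Πʳ v : HeightOneSpectrum (𝓞 ↥(maximalRealSubfield L)), [↥(localPi L (IsCMField.complexConj L) N H v), localInt L (IsCMField.complexConj L) N H v])]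
  [SecondCountableTopology (Πʳ v : HeightOneSpectrum (𝓞 ↥(maximalRealSubfield L)), [↥(localPi L (IsCMField.complexConj L) N H v), localInt L (IsCMField.complexConj L) N H v])]
  [∀ v, MeasurableSpace (↥(localPi L (IsCMField.complexConj L) N H v) ⧸ Subgroup.centralizer
    ({finAdelicEquiv (↥(maximalRealSubfield L)) L (IsCMField.complexConj L) N H (finPart (↥(maximalRealSubfield L)) L (IsCMField.complexConj L) N H g) v} :
      Set ↥(localPi L (IsCMField.complexConj L) N H v)))]
  [∀ v, BorelSpace (↥(localPi L (IsCMField.complexConj L) N H v) ⧸ Subgroup.centralizer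
    ({finAdelicEquiv (↥(maximalRealSubfield L)) L (IsCMField.complexConj L) N H (finPart (↥(maximalRealSubfield L)) L (IsCMField.complexConj L) N H g) v} :
      Set ↥(localPi L (IsCMField.complexConj L) N H v)))]
  [MeasurableSpace ((Πʳ v : HeightOneSpectrum (𝓞 ↥(maximalRealSubfield L)), [↥(localPi L (IsCMField.complexConj L) N H v), localInt L (IsCMField.complexConj L) N H v]) ⧸
    Subgroup.centralizer ({finAdelicEquiv (↥(maximalRealSubfield L)) L (IsCMField.complexConj L) N H (finPart (↥(maximalRealSubfield L)) L (IsCMField.complexConj L) N H g)} :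
      Set (Πʳ v : HeightOneSpectrum (𝓞 ↥(maximalRealSubfield L)), [↥(localPi L (IsCMField.complexConj L) N H v), localInt L (IsCMField.complexConj L) N H v])))]
  [BorelSpace ((Πʳ v : HeightOneSpectrum (𝓞 ↥(maximalRealSubfield L)), [↥(localPi L (IsCMField.complexConj L) N H v), localInt L (IsCMField.complexConj L) N H v]) ⧸
    Subgroup.centralizer ({finAdelicEquiv (↥(maximalRealSubfield L)) L (IsCMField.complexConj L) N H (finPart (↥(maximalRealSubfield L)) L (IsCMField.complexConj L) N H g)} :
      Set (Πʳ v : HeightOneSpectrum (𝓞 ↥(maximalRealSubfield L)), [↥(localPi L (IsCMField.complexConj L) N H v), localInt L (IsCMField.complexConj L) N H v])))]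
  [MeasurableSpace ((Πʳ v : HeightOneSpectrum (𝓞 ↥(maximalRealSubfield L)), [↥(localPi L (IsCMField.complexConj L) N H v), localInt L (IsCMField.complexConj L) N H v]) ⧸
    (cutout (fun v => localInt L (IsCMField.complexConj L) N H v) (fun v => Subgroup.centralizer
      ({finAdelicEquiv (↥(maximalRealSubfield L)) L (IsCMField.complexConj L) N H (finPart (↥(maximalRealSubfield L)) L (IsCMField.complexConj L) N H g) v} :
        Set ↥(localPi L (IsCMField.complexConj L) N H v))) : Subgroup _))]
  [BorelSpace ((Πʳ v : HeightOneSpectrum (𝓞 ↥(maximalRealSubfield L)), [↥(localPi L (IsCMField.complexConj L) N H v), localInt L (IsCMField.complexConj L) N H v]) ⧸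
    (cutout (fun v => localInt L (IsCMField.complexConj L) N H v) (fun v => Subgroup.centralizer
      ({finAdelicEquiv (↥(maximalRealSubfield L)) L (IsCMField.complexConj L) N H (finPart (↥(maximalRealSubfield L)) L (IsCMField.complexConj L) N H g) v} :
        Set ↥(localPi L (IsCMField.complexConj L) N H v))) : Subgroup _))]
  -- structures on `U(H)(𝔸_{L⁺,f})` (dischargeable: ★ `UnitaryGroupAdelicProductHaar` §2, `borel`)
  [MeasurableSpace (finAdelic (↥(maximalRealSubfield L)) L (IsCMField.complexConj L) N H)] [BorelSpace (finAdelic (↥(maximalRealSubfield L)) L (IsCMField.complexConj L) N H)]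
  [LocallyCompactSpace (finAdelic (↥(maximalRealSubfield L)) L (IsCMField.complexConj L) N H)]
  [SecondCountableTopology (finAdelic (↥(maximalRealSubfield L)) L (IsCMField.complexConj L) N H)]
  [T2Space (finAdelic (↥(maximalRealSubfield L)) L (IsCMField.complexConj L) N H)]
  [hKc : ∀ v, CompactSpace (localInt L (IsCMField.complexConj L) N H v)]
  [hCP : ∀ v, IsClosed ((Subgroup.centralizer ({finAdelicEquiv (↥(maximalRealSubfield L)) L (IsCMField.complexConj L) N H
    (finPart (↥(maximalRealSubfield L)) L (IsCMField.complexConj L) N H g) v} : Set ↥(localPi L (IsCMField.complexConj L) N H v))) : Set ↥(localPi L (IsCMField.complexConj L) N H v))]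
  [hCL : ∀ v, IsClosed ((Subgroup.centralizer ({((cmDatum L N H).toLocal v g)} : Set ((cmDatum L N H).Local v))) : Set ((cmDatum L N H).Local v))]
  -- the local Haar data on `U(H)(L⁺_v)` and on the local centralisers
  (ν : ∀ v, Measure ((cmDatum L N H).Local v)) [∀ v, IsHaarMeasure (ν v)] [∀ v, (ν v).IsMulRightInvariant]
  (t : ∀ v, Measure (Subgroup.centralizer ({((cmDatum L N H).toLocal v g)} : Set ((cmDatum L N H).Local v))))
  [∀ v, IsHaarMeasure (t v)] [∀ v, (t v).IsInvInvariant]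
  (S₀ : Finset (HeightOneSpectrum (𝓞 ↥(maximalRealSubfield L))))
  -- the global measures (expressions, with their equations)
  (νrp : Measure (Πʳ v : HeightOneSpectrum (𝓞 ↥(maximalRealSubfield L)), [↥(localPi L (IsCMField.complexConj L) N H v), localInt L (IsCMField.complexConj L) N H v]))
  [IsHaarMeasure νrp] [νrp.IsMulRightInvariant]
  (ρ : Measure (cutout (fun v => localInt L (IsCMField.complexConj L) N H v) (fun v => Subgroup.centralizer
      ({finAdelicEquiv (↥(maximalRealSubfield L)) L (IsCMField.complexConj L) N H (finPart (↥(maximalRealSubfield L)) L (IsCMField.complexConj L) N H g) v} :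
        Set ↥(localPi L (IsCMField.complexConj L) N H v))) : Subgroup (Πʳ v : HeightOneSpectrum (𝓞 ↥(maximalRealSubfield L)),
          [↥(localPi L (IsCMField.complexConj L) N H v), localInt L (IsCMField.complexConj L) N H v])))
  [ρ.IsMulLeftInvariant] [IsFiniteMeasureOnCompacts ρ] [ρ.IsOpenPosMeasure] [ρ.IsInvInvariant] [SFinite ρ]
  (ρM : Measure (Subgroup.centralizer ({finAdelicEquiv (↥(maximalRealSubfield L)) L (IsCMField.complexConj L) N H
    (finPart (↥(maximalRealSubfield L)) L (IsCMField.complexConj L) N H g)} :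
      Set (Πʳ v : HeightOneSpectrum (𝓞 ↥(maximalRealSubfield L)), [↥(localPi L (IsCMField.complexConj L) N H v), localInt L (IsCMField.complexConj L) N H v]))))
  [ρM.IsMulLeftInvariant] [IsFiniteMeasureOnCompacts ρM] [ρM.IsOpenPosMeasure] [ρM.IsInvInvariant] [SFinite ρM]
  (νf : Measure (finAdelic (↥(maximalRealSubfield L)) L (IsCMField.complexConj L) N H)) [IsHaarMeasure νf] [νf.IsMulRightInvariant]
  (tf : Measure (Subgroup.centralizer ({(finPart (↥(maximalRealSubfield L)) L (IsCMField.complexConj L) N H g)} :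
    Set (finAdelic (↥(maximalRealSubfield L)) L (IsCMField.complexConj L) N H))))
  [tf.IsMulLeftInvariant] [IsFiniteMeasureOnCompacts tf] [tf.IsOpenPosMeasure] [tf.IsInvInvariant] [SFinite tf]

set_option maxHeartbeats 1600000 in
set_option synthInstance.maxHeartbeats 400000 in
-- HB: the concrete `cmDatum` ∕ restricted-product carrier types are expensive to unify (statement elaboration; the proof is one `exact`)
/-- **`ofLocal (dg_v ∕ dt_v) = dg_f ∕ dt_f` on `U(H)(𝔸_{L⁺,f}) ⧸ C(g_f)`, Weil constant ONE** (the `U(H)` reading of ★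
`orbitalMeasureOfLocal_eq_quotientMeasure`).  Data: Haar measures `ν_v` on `U(H)(L⁺_v)` and `t_v` on the local centralisers `C(g_v)`; their transports
`ν′_v`, `t′_v` to the restricted-product model `U(H)(F_v) ≅ localPi v` along `ψ_v = localPiEquiv v` (hypothesis `hm`: `(ψ_v⁻¹)_*(ν_v ∕ t_v) = ν′_v ∕ t′_v`,
which is ★ `map_cosetCongr_quotientMeasure`), normalised off `S₀` (`hν1`, `ht1`, `hm1` on the model side); the restricted-product measures
`ν_rp = ∏'(ν′_v ; U(H)(𝒪_v))`, `t_M` and their transports `ν_f`, `t_f` to `U(H)(𝔸_{L⁺,f})`, `C(g_f)` along `finAdelicEquiv⁻¹` (EXPRESSIONS with their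
equations `hνrp hρ hρM hνf htf`).  Then
`finAdelicOrbitalMeasureOfLocal L N H g (v ↦ quotientMeasure C(g_v) t_v ν_v) S₀ = quotientMeasure C(g_f) t_f ν_f`. [cite: Rogawski1990, §5.4 p. 72] -/
theorem finAdelicOrbitalMeasureOfLocal_quotientMeasure_eq
    (hCf : IsClosed ((Subgroup.centralizer ({(finPart (↥(maximalRealSubfield L)) L (IsCMField.complexConj L) N H g)} : Set (finAdelic (↥(maximalRealSubfield L)) L (IsCMField.complexConj L) N H))) : Set (finAdelic (↥(maximalRealSubfield L)) L (IsCMField.complexConj L) N H)))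
    (ψ : ∀ v, ↥(localPi L (IsCMField.complexConj L) N H v) ≃ₜ* (cmDatum L N H).Local v) (hψ : ψ = fun v => localPiEquiv L (IsCMField.complexConj L) N H v)
    (hC : ∀ v, ∀ x : (cmDatum L N H).Local v, (ψ v).symm.toMulEquiv x ∈ Subgroup.centralizer ({finAdelicEquiv (↥(maximalRealSubfield L)) L (IsCMField.complexConj L) N H (finPart (↥(maximalRealSubfield L)) L (IsCMField.complexConj L) N H g) v} : Set ↥(localPi L (IsCMField.complexConj L) N H v)) ↔ x ∈ Subgroup.centralizer ({((cmDatum L N H).toLocal v g)} : Set ((cmDatum L N H).Local v)))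
    (hCrp : ∀ x : (Πʳ v : HeightOneSpectrum (𝓞 ↥(maximalRealSubfield L)), [↥(localPi L (IsCMField.complexConj L) N H v), localInt L (IsCMField.complexConj L) N H v]), (finAdelicEquiv (↥(maximalRealSubfield L)) L (IsCMField.complexConj L) N H).symm.toMulEquiv x ∈ Subgroup.centralizer ({(finPart (↥(maximalRealSubfield L)) L (IsCMField.complexConj L) N H g)} : Set (finAdelic (↥(maximalRealSubfield L)) L (IsCMField.complexConj L) N H)) ↔ x ∈ Subgroup.centralizer ({finAdelicEquiv (↥(maximalRealSubfield L)) L (IsCMField.complexConj L) N H (finPart (↥(maximalRealSubfield L)) L (IsCMField.complexConj L) N H g)} : Set (Πʳ v : HeightOneSpectrum (𝓞 ↥(maximalRealSubfield L)), [↥(localPi L (IsCMField.complexConj L) N H v), localInt L (IsCMField.complexConj L) N H v])))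
    (ν' : ∀ v, Measure ↥(localPi L (IsCMField.complexConj L) N H v)) [∀ v, IsHaarMeasure (ν' v)] [∀ v, (ν' v).IsMulRightInvariant]
    (t' : ∀ v, Measure (Subgroup.centralizer ({finAdelicEquiv (↥(maximalRealSubfield L)) L (IsCMField.complexConj L) N H (finPart (↥(maximalRealSubfield L)) L (IsCMField.complexConj L) N H g) v} : Set ↥(localPi L (IsCMField.complexConj L) N H v)))) [∀ v, (t' v).IsMulLeftInvariant] [∀ v, IsFiniteMeasureOnCompacts (t' v)]
    [∀ v, (t' v).IsOpenPosMeasure] [∀ v, (t' v).IsInvInvariant] [∀ v, SFinite (t' v)] [∀ v, SigmaFinite (t' v)]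
    (hm : ∀ v, Measure.map (cosetCongr (ψ v).symm.toMulEquiv (Subgroup.centralizer ({((cmDatum L N H).toLocal v g)} : Set ((cmDatum L N H).Local v))) (Subgroup.centralizer ({finAdelicEquiv (↥(maximalRealSubfield L)) L (IsCMField.complexConj L) N H (finPart (↥(maximalRealSubfield L)) L (IsCMField.complexConj L) N H g) v} : Set ↥(localPi L (IsCMField.complexConj L) N H v))) (hC v))
      (quotientMeasure (Subgroup.centralizer ({((cmDatum L N H).toLocal v g)} : Set ((cmDatum L N H).Local v))) (t v) (hCL v) (ν v)) = quotientMeasure (Subgroup.centralizer ({finAdelicEquiv (↥(maximalRealSubfield L)) L (IsCMField.complexConj L) N H (finPart (↥(maximalRealSubfield L)) L (IsCMField.complexConj L) N H g) v} : Set ↥(localPi L (IsCMField.complexConj L) N H v))) (t' v) (hCP v) (ν' v))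
    (hν1 : ∀ v, v ∉ S₀ → ν' v (localInt L (IsCMField.complexConj L) N H v : Set ↥(localPi L (IsCMField.complexConj L) N H v)) = 1)
    (ht1 : ∀ v, v ∉ S₀ → t' v ((inH (fun v => localInt L (IsCMField.complexConj L) N H v) (fun v => Subgroup.centralizer ({finAdelicEquiv (↥(maximalRealSubfield L)) L (IsCMField.complexConj L) N H (finPart (↥(maximalRealSubfield L)) L (IsCMField.complexConj L) N H g) v} : Set ↥(localPi L (IsCMField.complexConj L) N H v))) v : Subgroup (Subgroup.centralizer ({finAdelicEquiv (↥(maximalRealSubfield L)) L (IsCMField.complexConj L) N H (finPart (↥(maximalRealSubfield L)) L (IsCMField.complexConj L) N H g) v} : Set ↥(localPi L (IsCMField.complexConj L) N H v)))) : Set (Subgroup.centralizer ({finAdelicEquiv (↥(maximalRealSubfield L)) L (IsCMField.complexConj L) N H (finPart (↥(maximalRealSubfield L)) L (IsCMField.complexConj L) N H g) v} : Set ↥(localPi L (IsCMField.complexConj L) N H v)))) = 1)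
    (hm1 : ∀ v, v ∉ S₀ → quotientMeasure (Subgroup.centralizer ({finAdelicEquiv (↥(maximalRealSubfield L)) L (IsCMField.complexConj L) N H (finPart (↥(maximalRealSubfield L)) L (IsCMField.complexConj L) N H g) v} : Set ↥(localPi L (IsCMField.complexConj L) N H v))) (t' v) (hCP v) (ν' v) (quotBase (fun v => localInt L (IsCMField.complexConj L) N H v) (fun v => Subgroup.centralizer ({finAdelicEquiv (↥(maximalRealSubfield L)) L (IsCMField.complexConj L) N H (finPart (↥(maximalRealSubfield L)) L (IsCMField.complexConj L) N H g) v} : Set ↥(localPi L (IsCMField.complexConj L) N H v))) v) = 1)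
    (hνrp : νrp = rpMeasure (fun v => (localInt L (IsCMField.complexConj L) N H v : Set ↥(localPi L (IsCMField.complexConj L) N H v))) ν' S₀)
    (hρ : ρ = Measure.map (cutoutEquiv (fun v => localInt L (IsCMField.complexConj L) N H v) (fun v => Subgroup.centralizer ({finAdelicEquiv (↥(maximalRealSubfield L)) L (IsCMField.complexConj L) N H (finPart (↥(maximalRealSubfield L)) L (IsCMField.complexConj L) N H g) v} : Set ↥(localPi L (IsCMField.complexConj L) N H v))))
      (rpMeasure (fun v => ((inH (fun v => localInt L (IsCMField.complexConj L) N H v) (fun v => Subgroup.centralizer ({finAdelicEquiv (↥(maximalRealSubfield L)) L (IsCMField.complexConj L) N H (finPart (↥(maximalRealSubfield L)) L (IsCMField.complexConj L) N H g) v} : Set ↥(localPi L (IsCMField.complexConj L) N H v))) v : Subgroup (Subgroup.centralizer ({finAdelicEquiv (↥(maximalRealSubfield L)) L (IsCMField.complexConj L) N H (finPart (↥(maximalRealSubfield L)) L (IsCMField.complexConj L) N H g) v} : Set ↥(localPi L (IsCMField.complexConj L) N H v)))) : Set (Subgroup.centralizer ({finAdelicEquiv (↥(maximalRealSubfield L))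 L (IsCMField.complexConj L) N H (finPart (↥(maximalRealSubfield L)) L (IsCMField.complexConj L) N H g) v} : Set ↥(localPi L (IsCMField.complexConj L) N H v))))) t' S₀))
    (hρM : ρM = Measure.map (subgroupCongrHomeomorph (MulEquiv.refl (Πʳ v : HeightOneSpectrum (𝓞 ↥(maximalRealSubfield L)), [↥(localPi L (IsCMField.complexConj L) N H v), localInt L (IsCMField.complexConj L) N H v]))
      (cutout (fun v => localInt L (IsCMField.complexConj L) N H v) (fun v => Subgroup.centralizer ({finAdelicEquiv (↥(maximalRealSubfield L)) L (IsCMField.complexConj L) N H (finPart (↥(maximalRealSubfield L)) L (IsCMField.complexConj L) N H g) v} : Set ↥(localPi L (IsCMField.complexConj L) N H v)))) (Subgroup.centralizer ({finAdelicEquiv (↥(maximalRealSubfield L)) L (IsCMField.complexConj L) N H (finPart (↥(maximalRealSubfield L)) L (IsCMField.complexConj L) N H g)} : Set (Πʳ v : HeightOneSpectrum (𝓞 ↥(maximalRealSubfield L)), [↥(localPi L (IsCMField.complexConj L) N H v), localInt L (IsCMField.complexConj L) N H v])))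
      (forall_refl_mem_iff (fun v => localInt L (IsCMField.complexConj L) N H v) (fun v => Subgroup.centralizer ({finAdelicEquiv (↥(maximalRealSubfield L)) L (IsCMField.complexConj L) N H (finPart (↥(maximalRealSubfield L)) L (IsCMField.complexConj L) N H g) v} : Set ↥(localPi L (IsCMField.complexConj L) N H v))) _
        (mem_centralizer_singleton_iff_forall_mem (fun v => localInt L (IsCMField.complexConj L) N H v) (finAdelicEquiv (↥(maximalRealSubfield L)) L (IsCMField.complexConj L) N H (finPart (↥(maximalRealSubfield L)) L (IsCMField.complexConj L) N H g))))
      continuous_id continuous_id) ρ)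
    (hνf : νf = Measure.map (finAdelicEquiv (↥(maximalRealSubfield L)) L (IsCMField.complexConj L) N H).symm.toMulEquiv νrp)
    (htf : tf = Measure.map (subgroupCongrHomeomorph (finAdelicEquiv (↥(maximalRealSubfield L)) L (IsCMField.complexConj L) N H).symm.toMulEquiv (Subgroup.centralizer ({finAdelicEquiv (↥(maximalRealSubfield L)) L (IsCMField.complexConj L) N H (finPart (↥(maximalRealSubfield L)) L (IsCMField.complexConj L) N H g)} : Set (Πʳ v : HeightOneSpectrum (𝓞 ↥(maximalRealSubfield L)), [↥(localPi L (IsCMField.complexConj L) N H v), localInt L (IsCMField.complexConj L) N H v]))) (Subgroup.centralizer ({(finPart (↥(maximalRealSubfield L)) L (IsCMField.complexConj L) N H g)} : Set (finAdelic (↥(maximalRealSubfield L)) L (IsCMField.complexConj L) N H))) hCrp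
      (finAdelicEquiv (↥(maximalRealSubfield L)) L (IsCMField.complexConj L) N H).symm.continuous (finAdelicEquiv (↥(maximalRealSubfield L)) L (IsCMField.complexConj L) N H).continuous) ρM) :
    finAdelicOrbitalMeasureOfLocal L N H g (fun v => quotientMeasure (Subgroup.centralizer ({((cmDatum L N H).toLocal v g)} : Set ((cmDatum L N H).Local v))) (t v) (hCL v) (ν v)) S₀ =
      quotientMeasure (Subgroup.centralizer ({(finPart (↥(maximalRealSubfield L)) L (IsCMField.complexConj L) N H g)} : Set (finAdelic (↥(maximalRealSubfield L)) L (IsCMField.complexConj L) N H))) tf hCf νf := by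
  haveI : Countable (HeightOneSpectrum (𝓞 ↥(maximalRealSubfield L))) := countable_heightOneSpectrum ↥(maximalRealSubfield L)
  subst hψ
  exact orbitalMeasureOfLocal_eq_quotientMeasure (fun v => localInt L (IsCMField.complexConj L) N H v) _ (finAdelicEquiv (↥(maximalRealSubfield L)) L (IsCMField.complexConj L) N H) (finPart (↥(maximalRealSubfield L)) L (IsCMField.complexConj L) N H g)
    (fun v => (cmDatum L N H).toLocal v g) (fun v => localPiEquiv_evalPlace_finPart (↥(maximalRealSubfield L)) L (IsCMField.complexConj L) N H v g) _ ν' t' S₀ νrp ρ ρM νf tf hCf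
    hm hν1 ht1 hm1 hνrp hρ hρM hνf htf

end Fin

end UnitaryGroup

end Literature.NumberTheory.Automorphic
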